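import Literature.NumberTheory.LFunctions.Zhang2022.KnifeEdgeLenSiegelFamily

/-!
# Zhang (2022), rung F-S3 (Landau–Siegel programme, §D edge len = E*-len⁺): card `siegel-model-family-index`
# (ls-knife-len-idea-2) — the TRANSFER CALCULUS between Zhang's prime family and the Siegel family, PROVED FROM
# the card's first lemma K1 `KnifeEdge.SiegelModuliTransfer c` (which stays a hypothesis)

Y. Zhang, *Discrete mean estimates and the Landau–Siegel zero*, arXiv:2211.02515v1 [Zhang2022LandauSiegel] —
an unrefereed manuscript under adjudication; T. Tao, J. Teräväinen [TaoTeravainen2021] (the Siegel model).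
**WHAT THIS IS NOT: not a claim about Theorems 1–2 of arXiv:2211.02515, about
Landau–Siegel zeros, or about Parity. The programme SEARCHES and TYPES; no claim about Landau–Siegel zeros,
Theorems 1–2 of arXiv:2211.02515 or a repaired Margin232 until a kernel theorem says so. Every `theorem` here is an
implication whose hypothesis is the OPEN `Prop` `SiegelModuliTransfer c` (K1, `KnifeEdgeLenSiegelModuli`, p466795),
plus finite bookkeeping and the tree's PNT on the window (`frakP_bounds`); nothing asserts K1.**

WHAT IS PROVED (objects from `KnifeEdgeLenSiegelFamily`: `SChr`, `toS`, `siegelDensity` `w = Λ_Siegel/log`,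
`frakPS = 𝔓_S`, slices `modPolar`/`modMean`, `discPolarS`/`discMeanS`):
* Part 1. `SiegelModuliTransfer.density` — K1 in DENSITY form: under (A), eventually, for every `G` with
  `0 ≤ G ≤ B` on the window, `|Σ_{p∼P} G(p) − Σ_{m∈W} w(m)G(m)| ≤ B·|W|·𝓛⁻⁹·𝓛^{−c}` (K1 on `G/log`; `log m ≥ 𝓛⁹`
  on the window; the threshold is uniform in `(G, B)`); the normaliser transfer `|𝔓 − 𝔓_S| ≤ 2P|W|𝓛⁻⁹𝓛^{−c}`
  (`frakP_sub_frakPS`) and, for `c > 0`, its relative form `|𝔓 − 𝔓_S| ≤ ε𝔓` (`frakPS_rel`, via `frakP_bounds`).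
* Part 2. `SiegelModuliTransfer.densityDefect_le` (complex statistics, four sign parts) and **the generic
  polar-form transfer** `SiegelModuliTransfer.discPolar_transfer`: under (A), eventually, for ALL tables `U V` on
  the Siegel family with `‖modPolar U V m‖ ≤ B` at EVERY modulus of the window,
  `‖discPolar (U∘toS) (V∘toS) − discPolarS U V‖ ≤ 4B·|W|·𝓛⁻⁹𝓛^{−c}`.
* Part 3. The sup/avg bookkeeping in exponent form: with `B = 𝓛^κ·𝔞·P` («every modulus carries at most `𝓛^κ`
  times one prime modulus's share `𝔞·p` of a main term `k𝔞𝔓`») the defect is `≤ ε𝔞𝔓` eventually whenever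
  `κ < c` (`discPolar_transfer_of_sliceSup`, `discMean_transfer_of_sliceSup`). This displayed hypothesis is the
  referee's currency condition «sup_m G ≤ 𝓛^{c−1}·avg» (ls-ref-1 2026-08-26T21:21Z): beyond the wall (`θ > 1`) it is
  NOT known a priori (additive large sieve: slice `≲ (P^{θ−1}+1)`× share), which is why the slot transfers of the
  companion `KnifeEdgeLenSiegelSlots` carry it by name.

Typer: ls-knife-typer-1 (cell landau-siegel §D); critic's work order ls-knife-crit-1 2026-08-26T21:28Z.

## References
* Y. Zhang, arXiv:2211.02515v1 (2022), §2 p.4, (2.9), (2.16)–(2.17), §8 (8.3). [cite: Zhang2022LandauSiegel, §2, §8]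
* T. Tao, J. Teräväinen, arXiv:2109.06291, §5 Prop. 5.2 (the Siegel model and its accuracy). [cite: TaoTeravainen2021, §5]
-/

noncomputable section

open Finset Real Complex ComplexConjugate

namespace Literature.NumberTheory.LFunctions.Zhang2022.KnifeEdge

open Skeleton
open Literature.Barriers.Parity.TaoTeravainen (IsSmoothCutoff)

variable {D : ℕ}

/-! ### Part 1 — K1 in density form and the normaliser transfer (proved FROM K1, which stays a hypothesis) -/

section DensityTransfer

/-- Eventually every fixed real is below `𝓛 = log D` (bookkeeping of the standing quantifier «`D` greater than a
sufficiently large number»; private copy, the tree's public one lives in `Section17Eval1710`).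
[cite: Zhang2022LandauSiegel, §2 p.4] -/
private theorem forAllLarge_le_ell (X : ℝ) : ForAllLarge fun D _ _ => X ≤ ell D := by
  refine ForAllLarge.of_le (⌈Real.exp X⌉₊ + 1) fun D _ χ hD _ _ => ?_
  have hDexp : Real.exp X ≤ D := (Nat.le_ceil _).trans (by exact_mod_cast (by omega : ⌈Real.exp X⌉₊ ≤ D))
  rw [← Real.log_exp X]
  exact Real.log_le_log (Real.exp_pos _) hDexp

/-- Moduli of the window exceed `P`: `log m ≥ 𝓛⁹ = log P`, and `m ≤ 2P` once `𝓛 ≥ 1`.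
[cite: Zhang2022LandauSiegel, §2 p.4, (2.6)] -/
theorem window_bounds {D m : ℕ} (hm : m ∈ moduliWindow D) (hℓ : 1 ≤ ell D) :
    bigP D < m ∧ ell D ^ 9 ≤ Real.log m ∧ (m : ℝ) ≤ 2 * bigP D := by
  rw [moduliWindow, Finset.mem_Ioo] at hm
  have hP0 : 0 < bigP D := Real.exp_pos _
  have hPm : bigP D < m := (Nat.floor_lt hP0.le).mp hm.1
  refine ⟨hPm, ?_, ?_⟩
  · rw [← Real.log_exp (ell D ^ 9)]
    exact Real.log_le_log hP0 hPm.le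
  · have hlt : (m : ℝ) < bigP D * (1 + (ell D ^ 68)⁻¹) := Nat.lt_ceil.mp hm.2
    have h68 : (ell D ^ 68)⁻¹ ≤ 1 := inv_le_one_of_one_le₀ (one_le_pow₀ hℓ)
    nlinarith

/-- **K1 in DENSITY form (proved from K1).** Under (A), eventually: for every `G` with `0 ≤ G ≤ B` ON THE WINDOW,
`|Σ_{p∼P} G(p) − Σ_{m ∈ W} w(m)·G(m)| ≤ B·|W|·𝓛⁻⁹·𝓛^{−c}` — K1 applied to `G/log` (on the window `log m ≥ 𝓛⁹`; on
primes `log p·(G(p)/log p) = G(p)`). The threshold is uniform in `(G, B)`. [cite: Zhang2022LandauSiegel, §2 p.4, (2.9); TaoTeravainen2021, §5 Prop. 5.2] -/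
theorem SiegelModuliTransfer.density {c : ℝ} (hK : SiegelModuliTransfer c) {ψc : ℝ → ℝ}
    (hψ : IsSmoothCutoff ψc) :
    ForAllLarge fun D _ χ => AssumptionA D χ → ∀ (G : ℕ → ℝ) (B : ℝ), 0 ≤ B →
      (∀ m ∈ moduliWindow D, 0 ≤ G m ∧ G m ≤ B) →
        |∑ p ∈ primeWindow D, G p - ∑ m ∈ moduliWindow D, siegelDensity χ ψc m * G m|
          ≤ B * (bigP D * (ell D ^ 68)⁻¹) * ((ell D ^ 9)⁻¹ * (ell D ^ c)⁻¹) := by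
  classical
  refine ((hK ψc hψ).and (forAllLarge_le_ell 1)).mono fun D _ χ _ _ hh hA G B hB hG => ?_
  obtain ⟨hK1, hℓ⟩ := hh
  have hℓ9 : 0 < ell D ^ 9 := by positivity
  -- the test function `G/log` on the window
  set G' : ℕ → ℝ := fun m => if m ∈ moduliWindow D then G m / Real.log m else 0 with hG'
  have hG'0 : ∀ m, 0 ≤ G' m := fun m => by
    simp only [hG']
    split_ifs with hm
    · exact div_nonneg (hG m hm).1 (Real.log_natCast_nonneg m)
    · exact le_rfl
  have hG'B : ∀ m, G' m ≤ B / ell D ^ 9 := fun m => by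
    simp only [hG']
    split_ifs with hm
    · obtain ⟨_, hlog, _⟩ := window_bounds hm hℓ
      have hlog0 : 0 < Real.log m := lt_of_lt_of_le hℓ9 hlog
      calc G m / Real.log m ≤ B / Real.log m := div_le_div_of_nonneg_right (hG m hm).2 hlog0.le
        _ ≤ B / ell D ^ 9 := div_le_div_of_nonneg_left hB hℓ9 hlog
    · positivity
  have key := hK1 hA G' (B / ell D ^ 9) hG'0 hG'B
  -- identify the two sides
  have hprime : ∑ p ∈ primeWindow D, Real.log p * G' p = ∑ p ∈ primeWindow D, G p := by
    refine Finset.sum_congr rfl fun p hp => ?_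
    have hpW : p ∈ moduliWindow D := (Finset.mem_filter.mp hp).1
    obtain ⟨_, hlog, _⟩ := window_bounds hpW hℓ
    have hlog0 : Real.log p ≠ 0 := (lt_of_lt_of_le hℓ9 hlog).ne'
    simp only [hG', if_pos hpW]
    field_simp
  have hsiegel : ∑ m ∈ moduliWindow D, siegelModulusWeight χ ψc m * G' m
      = ∑ m ∈ moduliWindow D, siegelDensity χ ψc m * G m := by
    refine Finset.sum_congr rfl fun m hm => ?_
    simp only [hG', if_pos hm, siegelDensity]
    ring
  rw [hprime, hsiegel] at key
  refine key.trans (le_of_eq ?_)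
  field_simp

/-- **The normaliser transfer (proved from K1):** `|𝔓 − 𝔓_S| ≤ 2P·|W|·𝓛⁻⁹𝓛^{−c}` eventually under (A)
(density form with `G(m) = m ≤ 2P`). [cite: Zhang2022LandauSiegel, §2 (2.9)] -/
theorem SiegelModuliTransfer.frakP_sub_frakPS {c : ℝ} (hK : SiegelModuliTransfer c) {ψc : ℝ → ℝ}
    (hψ : IsSmoothCutoff ψc) :
    ForAllLarge fun D _ χ => AssumptionA D χ →
      |frakP D - frakPS D χ ψc| ≤ 2 * bigP D * (bigP D * (ell D ^ 68)⁻¹) * ((ell D ^ 9)⁻¹ * (ell D ^ c)⁻¹) := by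
  refine ((hK.density hψ).and (forAllLarge_le_ell 1)).mono fun D _ χ _ _ hh hA => ?_
  obtain ⟨hd, hℓ⟩ := hh
  have hP0 : 0 ≤ bigP D := (Real.exp_pos _).le
  have := hd hA (fun m => (m : ℝ)) (2 * bigP D) (by positivity)
    (fun m hm => ⟨Nat.cast_nonneg m, (window_bounds hm hℓ).2.2⟩)
  rw [frakP_eq_sum_primeWindow]
  exact this

/-- PNT on the window (`frakP_bounds`, in tree): eventually `P²𝓛⁻⁷⁷ ≤ 2𝔓`. [cite: Zhang2022LandauSiegel, §2 (2.9)] -/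
theorem forAllLarge_sq_le_two_frakP : ForAllLarge fun D _ _ => bigP D ^ 2 * (ell D ^ 77)⁻¹ ≤ 2 * frakP D := by
  obtain ⟨D₀, h₀⟩ := frakP_bounds
  refine ((ForAllLarge.of_le (S := fun D _ _ => |frakP D - bigP D ^ 2 * (ell D ^ 77)⁻¹|
      ≤ 3 * (ell D ^ 68)⁻¹ * (bigP D ^ 2 * (ell D ^ 77)⁻¹)) D₀ fun D _ _ hD _ _ => h₀ D hD).and
    (forAllLarge_le_ell 6)).mono fun D _ χ _ _ hh => ?_
  obtain ⟨hb, hℓ⟩ := hh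
  have hℓ1 : (1 : ℝ) ≤ ell D := by linarith
  have h68 : 3 * (ell D ^ 68)⁻¹ ≤ 1 / 2 := by
    rw [show (3 : ℝ) * (ell D ^ 68)⁻¹ = 3 / ell D ^ 68 by ring, div_le_div_iff₀ (by positivity) (by norm_num)]
    have : (6 : ℝ) ^ 1 ≤ ell D ^ 68 := by
      calc (6 : ℝ) ^ 1 = 6 := pow_one _
        _ ≤ ell D := hℓ
        _ = ell D ^ 1 := (pow_one _).symm
        _ ≤ ell D ^ 68 := pow_le_pow_right₀ hℓ1 (by norm_num)
    linarith
  have hX : 0 ≤ bigP D ^ 2 * (ell D ^ 77)⁻¹ := by positivity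
  have := (abs_sub_le_iff.mp hb).2
  nlinarith

/-- **Relative normaliser transfer (proved from K1 with `c > 0` and PNT on the window):** for every `ε > 0`,
eventually under (A), `|𝔓 − 𝔓_S| ≤ ε𝔓`. [cite: Zhang2022LandauSiegel, §2 (2.9)] -/
theorem SiegelModuliTransfer.frakPS_rel {c : ℝ} (hc : 0 < c) (hK : SiegelModuliTransfer c) {ψc : ℝ → ℝ}
    (hψ : IsSmoothCutoff ψc) {ε : ℝ} (hε : 0 < ε) :
    ForAllLarge fun D _ χ => AssumptionA D χ → |frakP D - frakPS D χ ψc| ≤ ε * frakP D := by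
  refine (((hK.frakP_sub_frakPS hψ).and forAllLarge_sq_le_two_frakP).and
    (forAllLarge_le_ell (max 1 ((4 / ε) ^ (1 / c))))).mono fun D _ χ _ _ hh hA => ?_
  obtain ⟨⟨h1, h2⟩, hℓ⟩ := hh
  have hℓ1 : 1 ≤ ell D := (le_max_left _ _).trans hℓ
  have hℓ0 : 0 < ell D := by linarith
  -- `𝓛^c ≥ 4/ε`
  have hc' : 4 / ε ≤ ell D ^ c := by
    have h := Real.rpow_le_rpow (by positivity) ((le_max_right _ _).trans hℓ) hc.le
    rwa [← Real.rpow_mul (by positivity), one_div_mul_cancel hc.ne', Real.rpow_one] at h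
  have hcpos : 0 < ell D ^ c := Real.rpow_pos_of_pos hℓ0 c
  have hinv : (ell D ^ c)⁻¹ ≤ ε / 4 := by
    rw [inv_le_comm₀ hcpos (by positivity)]
    calc (ε / 4)⁻¹ = 4 / ε := by rw [inv_div]
      _ ≤ ell D ^ c := hc'
  refine (h1 hA).trans ?_
  have hP2 : 2 * bigP D * (bigP D * (ell D ^ 68)⁻¹) * ((ell D ^ 9)⁻¹ * (ell D ^ c)⁻¹)
      = 2 * (bigP D ^ 2 * (ell D ^ 77)⁻¹) * (ell D ^ c)⁻¹ := by
    rw [show (ell D ^ 77)⁻¹ = (ell D ^ 68)⁻¹ * (ell D ^ 9)⁻¹ by rw [← mul_inv, ← pow_add]]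
    ring
  rw [hP2]
  have hX : 0 ≤ bigP D ^ 2 * (ell D ^ 77)⁻¹ := by positivity
  calc 2 * (bigP D ^ 2 * (ell D ^ 77)⁻¹) * (ell D ^ c)⁻¹
      ≤ 2 * (2 * frakP D) * (ε / 4) :=
        mul_le_mul (mul_le_mul_of_nonneg_left h2 (by norm_num)) hinv (inv_nonneg.mpr hcpos.le)
          (by linarith [frakP_nonneg D])
    _ = ε * frakP D := by ring

end DensityTransfer

/-! ### Part 2 — the generic transfer of a discrete polar form from the Siegel family to the prime family (proved from K1) -/

section PolarTransfer

variable {c' : ℝ}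

/-- The density defect of a complex statistic `H` of the modulus: `Σ_{p∼P} H(p) − Σ_{m∈W} w(m)·H(m)`.
[cite: Zhang2022LandauSiegel, §2 p.4] -/
def densityDefect (χ : DirichletCharacter ℂ D) (ψc : ℝ → ℝ) (H : ℕ → ℂ) : ℂ :=
  ∑ p ∈ primeWindow D, H p - ∑ m ∈ moduliWindow D, (siegelDensity χ ψc m : ℂ) * H m

/-- The density defect is additive. [cite: Zhang2022LandauSiegel, §2 p.4] -/
theorem densityDefect_add (χ : DirichletCharacter ℂ D) (ψc : ℝ → ℝ) (H₁ H₂ : ℕ → ℂ) :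
    densityDefect χ ψc (fun m => H₁ m + H₂ m) = densityDefect χ ψc H₁ + densityDefect χ ψc H₂ := by
  simp only [densityDefect, mul_add, Finset.sum_add_distrib]
  ring

/-- The density defect is homogeneous. [cite: Zhang2022LandauSiegel, §2 p.4] -/
theorem densityDefect_smul (χ : DirichletCharacter ℂ D) (ψc : ℝ → ℝ) (a : ℂ) (H : ℕ → ℂ) :
    densityDefect χ ψc (fun m => a * H m) = a * densityDefect χ ψc H := by
  simp only [densityDefect, mul_sub, Finset.mul_sum]
  congr 1
  exact Finset.sum_congr rfl fun m _ => by ring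

/-- On a real statistic the density defect is the real defect of `SiegelModuliTransfer.density`.
[cite: Zhang2022LandauSiegel, §2 p.4] -/
theorem densityDefect_ofReal (χ : DirichletCharacter ℂ D) (ψc : ℝ → ℝ) (G : ℕ → ℝ) :
    densityDefect χ ψc (fun m => (G m : ℂ))
      = ((∑ p ∈ primeWindow D, G p - ∑ m ∈ moduliWindow D, siegelDensity χ ψc m * G m : ℝ) : ℂ) := by
  simp only [densityDefect]
  push_cast
  rfl

/-- Decomposition of a complex number into four nonnegative real parts. [folklore] -/
private theorem decomp_four' (z : ℂ) :
    z = (((max z.re 0 : ℝ) : ℂ) - ((max (-z.re) 0 : ℝ) : ℂ))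
        + (((max z.im 0 : ℝ) : ℂ) - ((max (-z.im) 0 : ℝ) : ℂ)) * I := by
  have hre : ((max z.re 0 : ℝ) : ℂ) - ((max (-z.re) 0 : ℝ) : ℂ) = (z.re : ℂ) := by
    rw [← Complex.ofReal_sub, max_zero_sub_max_neg_zero_eq_self]
  have him : ((max z.im 0 : ℝ) : ℂ) - ((max (-z.im) 0 : ℝ) : ℂ) = (z.im : ℂ) := by
    rw [← Complex.ofReal_sub, max_zero_sub_max_neg_zero_eq_self]
  rw [hre, him]
  exact (Complex.re_add_im z).symm

/-- **Density transfer of a bounded COMPLEX statistic (proved from K1):** under (A), eventually, for every `H` with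
`‖H(m)‖ ≤ B` on the window, `‖Σ_p H(p) − Σ_m w(m)H(m)‖ ≤ 4B·|W|·𝓛⁻⁹𝓛^{−c}` (K1's density form on the four sign parts).
[cite: Zhang2022LandauSiegel, §2 p.4; TaoTeravainen2021, §5 Prop. 5.2] -/
theorem SiegelModuliTransfer.densityDefect_le {c : ℝ} (hK : SiegelModuliTransfer c) {ψc : ℝ → ℝ}
    (hψ : IsSmoothCutoff ψc) :
    ForAllLarge fun D _ χ => AssumptionA D χ → ∀ (H : ℕ → ℂ) (B : ℝ), 0 ≤ B →
      (∀ m ∈ moduliWindow D, ‖H m‖ ≤ B) →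
        ‖densityDefect χ ψc H‖ ≤ 4 * B * (bigP D * (ell D ^ 68)⁻¹) * ((ell D ^ 9)⁻¹ * (ell D ^ c)⁻¹) := by
  refine (hK.density hψ).mono fun D _ χ _ _ hd hA H B hB hH => ?_
  have hd := hd hA
  set E : ℝ := B * (bigP D * (ell D ^ 68)⁻¹) * ((ell D ^ 9)⁻¹ * (ell D ^ c)⁻¹) with hE
  set G₁ : ℕ → ℝ := fun m => max (H m).re 0 with hG₁
  set G₂ : ℕ → ℝ := fun m => max (-(H m).re) 0 with hG₂
  set G₃ : ℕ → ℝ := fun m => max (H m).im 0 with hG₃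
  set G₄ : ℕ → ℝ := fun m => max (-(H m).im) 0 with hG₄
  have hre : ∀ m ∈ moduliWindow D, |(H m).re| ≤ B := fun m hm => (Complex.abs_re_le_norm _).trans (hH m hm)
  have him : ∀ m ∈ moduliWindow D, |(H m).im| ≤ B := fun m hm => (Complex.abs_im_le_norm _).trans (hH m hm)
  have b₁ : ∀ m ∈ moduliWindow D, 0 ≤ G₁ m ∧ G₁ m ≤ B := fun m hm =>
    ⟨le_max_right _ _, max_le ((le_abs_self _).trans (hre m hm)) hB⟩
  have b₂ : ∀ m ∈ moduliWindow D, 0 ≤ G₂ m ∧ G₂ m ≤ B := fun m hm =>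
    ⟨le_max_right _ _, max_le ((neg_le_abs _).trans (hre m hm)) hB⟩
  have b₃ : ∀ m ∈ moduliWindow D, 0 ≤ G₃ m ∧ G₃ m ≤ B := fun m hm =>
    ⟨le_max_right _ _, max_le ((le_abs_self _).trans (him m hm)) hB⟩
  have b₄ : ∀ m ∈ moduliWindow D, 0 ≤ G₄ m ∧ G₄ m ≤ B := fun m hm =>
    ⟨le_max_right _ _, max_le ((neg_le_abs _).trans (him m hm)) hB⟩
  have k₁ := hd G₁ B hB b₁
  have k₂ := hd G₂ B hB b₂
  have k₃ := hd G₃ B hB b₃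
  have k₄ := hd G₄ B hB b₄
  have hsplit : densityDefect χ ψc H
      = (densityDefect χ ψc (fun m => (G₁ m : ℂ)) - densityDefect χ ψc (fun m => (G₂ m : ℂ)))
        + (densityDefect χ ψc (fun m => (G₃ m : ℂ)) - densityDefect χ ψc (fun m => (G₄ m : ℂ))) * I := by
    have hH' : H = fun m => ((fun m => (G₁ m : ℂ) + (-1) * (G₂ m : ℂ)) m
        + I * ((fun m => (G₃ m : ℂ) + (-1) * (G₄ m : ℂ)) m)) := by
      funext m
      have := decomp_four' (H m)
      simp only [hG₁, hG₂, hG₃, hG₄]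
      linear_combination this
    rw [hH', densityDefect_add, densityDefect_smul, densityDefect_add, densityDefect_add,
      densityDefect_smul, densityDefect_smul]
    ring
  rw [hsplit, densityDefect_ofReal, densityDefect_ofReal, densityDefect_ofReal, densityDefect_ofReal]
  have hI : ‖(I : ℂ)‖ = 1 := Complex.norm_I
  calc _ ≤ ‖((∑ p ∈ primeWindow D, G₁ p - ∑ m ∈ moduliWindow D, siegelDensity χ ψc m * G₁ m : ℝ) : ℂ)
            - ((∑ p ∈ primeWindow D, G₂ p - ∑ m ∈ moduliWindow D, siegelDensity χ ψc m * G₂ m : ℝ) : ℂ)‖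
          + ‖(((∑ p ∈ primeWindow D, G₃ p - ∑ m ∈ moduliWindow D, siegelDensity χ ψc m * G₃ m : ℝ) : ℂ)
            - ((∑ p ∈ primeWindow D, G₄ p - ∑ m ∈ moduliWindow D, siegelDensity χ ψc m * G₄ m : ℝ) : ℂ))
              * I‖ := norm_add_le _ _
    _ ≤ (E + E) + (E + E) := by
        gcongr
        · refine (norm_sub_le _ _).trans (add_le_add ?_ ?_) <;>
            rw [Complex.norm_real, Real.norm_eq_abs]
          · exact k₁
          · exact k₂
        · rw [norm_mul, hI, mul_one]
          refine (norm_sub_le _ _).trans (add_le_add ?_ ?_) <;>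
            rw [Complex.norm_real, Real.norm_eq_abs]
          · exact k₃
          · exact k₄
    _ = 4 * B * (bigP D * (ell D ^ 68)⁻¹) * ((ell D ^ 9)⁻¹ * (ell D ^ c)⁻¹) := by rw [hE]; ring

/-- **THE GENERIC POLAR-FORM TRANSFER (proved from K1).** Under (A), eventually in `D`: for ALL tables `U V` on the
Siegel family whose per-modulus slices are bounded by `B` at EVERY modulus of the window, Zhang's prime-family polar
form of the restricted tables differs from the Siegel family's by `≤ 4B·|W|·𝓛⁻⁹𝓛^{−c}`.
[cite: Zhang2022LandauSiegel, §2 (2.17), §8 (8.3); TaoTeravainen2021, §5 Prop. 5.2] -/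
theorem SiegelModuliTransfer.discPolar_transfer {c : ℝ} (hK : SiegelModuliTransfer c) {ψc : ℝ → ℝ}
    (hψ : IsSmoothCutoff ψc) (c' : ℝ) :
    ForAllLarge fun D _ χ => AssumptionA D χ → ∀ (U V : SChr D → ℂ → ℂ) (B : ℝ), 0 ≤ B →
      (∀ m ∈ moduliWindow D, ‖modPolar c' χ U V m‖ ≤ B) →
        ‖discPolar c' χ (fun x => U (toS x)) (fun x => V (toS x)) - discPolarS c' χ ψc U V‖
          ≤ 4 * B * (bigP D * (ell D ^ 68)⁻¹) * ((ell D ^ 9)⁻¹ * (ell D ^ c)⁻¹) := by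
  refine (hK.densityDefect_le hψ).mono fun D _ χ _ _ hd hA U V B hB hUV => ?_
  have h := hd hA (modPolar c' χ U V) B hB hUV
  rwa [densityDefect, ← discPolar_eq_sum_modPolar] at h

/-- **The transfer with the sup/avg bookkeeping in exponent form.** If K1 holds with exponent `c` and `κ < c`, then
for every `ε > 0`, eventually under (A): for ALL tables whose slices satisfy `‖modPolar U V m‖ ≤ 𝓛^κ·𝔞·P` at every
modulus of the window («at most `𝓛^κ` times one prime modulus's share `𝔞·p` of a main term `k𝔞𝔓`»), the prime and
Siegel polar forms differ by `≤ ε𝔞𝔓` (uses PNT on the window, `frakP_bounds`). This displayed sup hypothesis is the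
referee's currency condition «sup_m G ≤ 𝓛^{c−1}·avg»; beyond the wall it is NOT known a priori (ls-ref-1 21:21Z).
[cite: Zhang2022LandauSiegel, §2 (2.9), (2.17), §8 (8.3); TaoTeravainen2021, §5 Prop. 5.2] -/
theorem SiegelModuliTransfer.discPolar_transfer_of_sliceSup {c κ : ℝ} (hκ : κ < c) (hK : SiegelModuliTransfer c)
    {ψc : ℝ → ℝ} (hψ : IsSmoothCutoff ψc) (c' : ℝ) {ε : ℝ} (hε : 0 < ε) :
    ForAllLarge fun D _ χ => AssumptionA D χ → ∀ (U V : SChr D → ℂ → ℂ),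
      (∀ m ∈ moduliWindow D, ‖modPolar c' χ U V m‖ ≤ ell D ^ κ * frakA χ * bigP D) →
        ‖discPolar c' χ (fun x => U (toS x)) (fun x => V (toS x)) - discPolarS c' χ ψc U V‖
          ≤ ε * frakA χ * frakP D := by
  have hcκ : 0 < c - κ := by linarith
  refine (((hK.discPolar_transfer hψ c').and forAllLarge_sq_le_two_frakP).and
    (forAllLarge_le_ell (max 1 ((8 / ε) ^ (1 / (c - κ)))))).mono fun D _ χ _ _ hh hA U V hUV => ?_
  obtain ⟨⟨h1, h2⟩, hℓ⟩ := hh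
  have hℓ1 : 1 ≤ ell D := (le_max_left _ _).trans hℓ
  have hℓ0 : 0 < ell D := by linarith
  have h𝔞 : 0 ≤ frakA χ := frakA_nonneg χ
  have hB : 0 ≤ ell D ^ κ * frakA χ * bigP D :=
    mul_nonneg (mul_nonneg (Real.rpow_nonneg hℓ0.le κ) h𝔞) (Real.exp_pos _).le
  refine (h1 hA U V _ hB hUV).trans ?_
  -- `𝓛^κ·𝓛^{−c} = 𝓛^{−(c−κ)} ≤ ε/8`
  have hpow : (8 / ε) ≤ ell D ^ (c - κ) := by
    have h := Real.rpow_le_rpow (by positivity) ((le_max_right _ _).trans hℓ) hcκ.le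
    rwa [← Real.rpow_mul (by positivity), one_div_mul_cancel hcκ.ne', Real.rpow_one] at h
  have hcκpos : 0 < ell D ^ (c - κ) := Real.rpow_pos_of_pos hℓ0 _
  have hratio : ell D ^ κ * (ell D ^ c)⁻¹ ≤ ε / 8 := by
    rw [← Real.rpow_neg hℓ0.le, ← Real.rpow_add hℓ0, show κ + -c = -(c - κ) by ring, Real.rpow_neg hℓ0.le,
      inv_le_comm₀ hcκpos (by positivity)]
    calc (ε / 8)⁻¹ = 8 / ε := by rw [inv_div]
      _ ≤ ell D ^ (c - κ) := hpow
  have hsq : bigP D * (bigP D * (ell D ^ 68)⁻¹) * (ell D ^ 9)⁻¹ = bigP D ^ 2 * (ell D ^ 77)⁻¹ := by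
    rw [show (ell D ^ 77)⁻¹ = (ell D ^ 68)⁻¹ * (ell D ^ 9)⁻¹ by rw [← mul_inv, ← pow_add]]
    ring
  calc 4 * (ell D ^ κ * frakA χ * bigP D) * (bigP D * (ell D ^ 68)⁻¹) * ((ell D ^ 9)⁻¹ * (ell D ^ c)⁻¹)
      = 4 * frakA χ * (bigP D * (bigP D * (ell D ^ 68)⁻¹) * (ell D ^ 9)⁻¹) * (ell D ^ κ * (ell D ^ c)⁻¹) := by
        ring
    _ = 4 * frakA χ * (bigP D ^ 2 * (ell D ^ 77)⁻¹) * (ell D ^ κ * (ell D ^ c)⁻¹) := by rw [hsq]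
    _ ≤ 4 * frakA χ * (2 * frakP D) * (ε / 8) := by
        have hX : 0 ≤ ell D ^ κ * (ell D ^ c)⁻¹ :=
          mul_nonneg (Real.rpow_nonneg hℓ0.le κ) (inv_nonneg.mpr (Real.rpow_nonneg hℓ0.le c))
        exact mul_le_mul (mul_le_mul_of_nonneg_left h2 (by positivity)) hratio hX
          (mul_nonneg (by positivity) (by linarith [frakP_nonneg D]))
    _ = ε * frakA χ * frakP D := by ring

end PolarTransfer

section MeanTransfer

/-- **The real (mean) form of the transfer with the sup bookkeeping.** If K1 holds with exponent `c` and `κ < c`,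
then for every `ε > 0`, eventually under (A): for ALL tables `U` whose per-modulus mean slices satisfy
`|modMean U m| ≤ 𝓛^κ·𝔞·P` at every modulus of the window, Zhang's discrete mean of the restricted table and the
Siegel family's discrete mean differ by `≤ ε𝔞𝔓` (diagonal of `discPolar_transfer_of_sliceSup`).
[cite: Zhang2022LandauSiegel, §2 (2.16), §8 (8.3); TaoTeravainen2021, §5 Prop. 5.2] -/
theorem SiegelModuliTransfer.discMean_transfer_of_sliceSup {c κ : ℝ} (hκ : κ < c) (hK : SiegelModuliTransfer c)
    {ψc : ℝ → ℝ} (hψ : IsSmoothCutoff ψc) (c' : ℝ) {ε : ℝ} (hε : 0 < ε) :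
    ForAllLarge fun D _ χ => AssumptionA D χ → ∀ (U : SChr D → ℂ → ℂ),
      (∀ m ∈ moduliWindow D, |modMean c' χ U m| ≤ ell D ^ κ * frakA χ * bigP D) →
        |discMean c' χ (fun x => U (toS x)) - discMeanS c' χ ψc U| ≤ ε * frakA χ * frakP D := by
  refine (hK.discPolar_transfer_of_sliceSup hκ hψ c' hε).mono fun D _ χ _ _ h hA U hU => ?_
  have hUU : ∀ m ∈ moduliWindow D, ‖modPolar c' χ U U m‖ ≤ ell D ^ κ * frakA χ * bigP D := fun m hm => by
    rw [modPolar_self, Complex.norm_real, Real.norm_eq_abs]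
    exact hU m hm
  have key := h hA U U hUU
  rw [discPolarS_self] at key
  have hre : discMean c' χ (fun x => U (toS x)) - discMeanS c' χ ψc U
      = (discPolar c' χ (fun x => U (toS x)) (fun x => U (toS x)) - (discMeanS c' χ ψc U : ℂ)).re := by
    rw [Complex.sub_re, discPolar_self_re, Complex.ofReal_re]
  rw [hre]
  exact (Complex.abs_re_le_norm _).trans key

end MeanTransfer

end Literature.NumberTheory.LFunctions.Zhang2022.KnifeEdge

end
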